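import Summits.AtomisticToContinuum.Crystallization.Theorems.ThreeConeCertificateExactCertificateFarEqual
import Summits.AtomisticToContinuum.Crystallization.Theorems.ThreeConeCertificateExactCertificateAllTemplatesExpSum
import Summits.AtomisticToContinuum.Crystallization.Theorems.ThreeConeCertificateExactCertificateAllTemplatesStructureFactor
import Summits.AtomisticToContinuum.Crystallization.Theorems.ThreeConeCertificateExactCertificateAllTemplatesNormsWindow
import HarnessLib

/-!
# Crux `ExactCertificate` (stmt-AtomisticToContinuum-11959), line `closure-makes-nogap-exact`, skeleton X (`AllTemplates`), part I:
# the WINDOW ENGINE and the invisibility theorem for EVERY periodic configuration of `ℝ³`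

Support file for the crux `ThreeConeCertificate.ExactCertificate`; nothing here closes the 3-D crux.  Skeleton VIII proved that no
nonzero finite-range continuous radial kernel is invisible to a Bravais / commensurate crystal; the caveat came from the structure factor,
which may vanish on parts of a dual plane.  Here the caveat is REMOVED: on a lattice line `n ↦ n k₁ + j k₂` the structure factor is an
exponential sum with at most `#motif` nonzero nodes, so by Vandermonde it is non-zero somewhere in every window of `#motif` consecutive `n`
unless it vanishes on the whole line, and non-vanishing lines occur in every window of `#motif` consecutive `j` (`stub_expSumWindow`,
`stub_structureFactorWindows`); zeros of an entire function of exponential type on such a WINDOW-DENSE subset of the norms of a dual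
plane are still superlinear (`stub_normsSuperlinearWindow`), so the engine runs:

* `entire_eq_zero_of_vanish_on_latticeNorms_window` — the window engine;
* `radial_eq_zero_of_fourier_vanish_window` — Fourier form;
* `allTemplates_noInvisibleKernel` — **for EVERY periodic configuration `P ⊂ ℝ³`, every continuous `α : ℝ → ℝ` vanishing on `[L,∞)`
  whose field `Σ_{y∈P} α(dist w y)` vanishes identically is `≡ 0` on `[0, ∞)`.**  All `[folklore]`.
-/

noncomputable section

namespace Summit.AtomisticToContinuum.Crystallization.Theorems.ThreeConeCertificateExactCertificate.AllTemplates

open Literature.MathematicalPhysics.StatisticalMechanics MeasureTheory Set Filter Topology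
open Summit.AtomisticToContinuum.Crystallization.Theorems.ChargedEnergyGapNegative (E3)
open Summit.AtomisticToContinuum.Crystallization.Theorems.ExactCertificateNegative (IsSplit)
open Summit.AtomisticToContinuum.Crystallization.Theorems.BraggSlacknessRigidityStrictCertificate
  (structureFactor_mul_fourier_eq_zero)
open Summit.AtomisticToContinuum.Crystallization.Theorems.ThreeConeCertificateExactCertificate.Invisibility
open Summit.AtomisticToContinuum.Crystallization.Theorems.ThreeConeCertificateExactCertificate.FarEqual
open scoped BigOperators FourierTransform RealInnerProductSpace

/-- **Window engine.** [folklore] An entire `Φ` of exponential type vanishing at `‖n k₁ + j k₂‖` for all `(n, j) ∈ D ∖ {0}`, `D` window-dense as in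
X3, `k₁, k₂` independent, vanishes identically. -/
theorem entire_eq_zero_of_vanish_on_latticeNorms_window (Φ : ℂ → ℂ) (hΦ : Differentiable ℂ Φ) {B τ : ℝ}
    (hB : ∀ z : ℂ, ‖Φ z‖ ≤ B * Real.exp (τ * ‖z‖)) {k₁ k₂ : E3} (hli : LinearIndependent ℝ ![k₁, k₂])
    (D : Set (ℤ × ℤ)) (w : ℕ) (hw : 0 < w)
    (hDwin : ∀ j₀ : ℤ, ∃ j : ℤ, j₀ ≤ j ∧ j < j₀ + w ∧ ∀ n₀ : ℤ, ∃ n : ℤ, n₀ ≤ n ∧ n < n₀ + w ∧ (n, j) ∈ D)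
    (hz : ∀ n j : ℤ, (n, j) ∈ D → (n, j) ≠ (0, 0) → Φ (‖(n : ℝ) • k₁ + (j : ℝ) • k₂‖ : ℂ) = 0) : ∀ z : ℂ, Φ z = 0 := by
  by_contra h
  rw [not_forall] at h
  obtain ⟨c, hc⟩ := h
  obtain ⟨C₁, C₂, hcount⟩ := stub_jensenCount Φ B τ c hΦ hB hc
  obtain ⟨R, Z, hR, hcard, hZ⟩ := stub_normsSuperlinearWindow stub_coincidenceFinite k₁ k₂ hli D w hw hDwin C₁ C₂
  have h1 := hcount R (Z.image fun s : ℝ => (s : ℂ)) hR ?_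
  · rw [Finset.card_image_of_injective _ Complex.ofReal_injective] at h1
    linarith
  · intro z hz'
    obtain ⟨s, hs, rfl⟩ := Finset.mem_image.1 hz'
    obtain ⟨hsR, n, j, hD, hnj, rfl⟩ := hZ s hs
    refine ⟨?_, hz n j hD hnj⟩
    rw [Complex.norm_real, Real.norm_eq_abs, abs_of_nonneg (norm_nonneg _)]
    exact hsR

/-- **No finite-range continuous radial kernel on `ℝ³` has Fourier transform vanishing on a window-dense subset of a lattice plane.** [folklore] -/
theorem radial_eq_zero_of_fourier_vanish_window (α : ℝ → ℝ) (L : ℝ) (hα : Continuous α)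
    (hL : ∀ r : ℝ, L ≤ r → α r = 0) {k₁ k₂ : E3} (hli : LinearIndependent ℝ ![k₁, k₂])
    (D : Set (ℤ × ℤ)) (w : ℕ) (hw : 0 < w)
    (hDwin : ∀ j₀ : ℤ, ∃ j : ℤ, j₀ ≤ j ∧ j < j₀ + w ∧ ∀ n₀ : ℤ, ∃ n : ℤ, n₀ ≤ n ∧ n < n₀ + w ∧ (n, j) ∈ D)
    (hz : ∀ n j : ℤ, (n, j) ∈ D → 𝓕 (fun v : E3 => (α ‖v‖ : ℂ)) ((n : ℝ) • k₁ + (j : ℝ) • k₂) = 0) :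
    ∀ r : ℝ, 0 ≤ r → α r = 0 := by
  obtain ⟨hAc, hAi, hAsupp⟩ := radialKernel_props α L hα hL
  obtain ⟨Φ, hΦd, ⟨B, τ, hB⟩, hΦF⟩ := stub_sliceEntire (fun v : E3 => (α ‖v‖ : ℂ)) L hAi hAsupp
  have hrad := stub_fourierRadial (fun r : ℝ => (α r : ℂ))
  have hzΦ : ∀ n j : ℤ, (n, j) ∈ D → (n, j) ≠ (0, 0) → Φ (‖(n : ℝ) • k₁ + (j : ℝ) • k₂‖ : ℂ) = 0 := by
    intro n j hD _
    rw [hΦF ‖(n : ℝ) • k₁ + (j : ℝ) • k₂‖, hrad _ ((n : ℝ) • k₁ + (j : ℝ) • k₂)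
      (norm_smul_single_zero_one (norm_nonneg _))]
    exact hz n j hD
  have hΦ0 := entire_eq_zero_of_vanish_on_latticeNorms_window Φ hΦd hB hli D w hw hDwin hzΦ
  have hFA : 𝓕 (fun v : E3 => (α ‖v‖ : ℂ)) = 0 := by
    funext ξ
    rw [hrad ξ (‖ξ‖ • EuclideanSpace.single (0 : Fin 3) (1 : ℝ)) (by rw [norm_smul_single_zero_one (norm_nonneg _)]),
      Pi.zero_apply, ← hΦF, hΦ0]
  have hinv := hAc.fourierInv_fourier_eq hAi (by rw [hFA]; exact integrable_zero _ _ _)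
  rw [hFA] at hinv
  intro r hr
  have hv := congrFun hinv (r • EuclideanSpace.single (0 : Fin 3) (1 : ℝ))
  rw [Real.fourierInv_eq'] at hv
  simp only [Pi.zero_apply, smul_zero, integral_zero] at hv
  rw [norm_smul_single_zero_one hr] at hv
  exact_mod_cast hv.symm

/-- **No finite-range continuous radial kernel is invisible to ANY periodic crystal of `ℝ³`** (skeleton VIII without the
commensurability caveat). [folklore] -/
theorem allTemplates_noInvisibleKernel (P : PeriodicConfiguration 3) (α : ℝ → ℝ) (L : ℝ)
    (hα : Continuous α) (hL : ∀ r : ℝ, L ≤ r → α r = 0)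
    (hinv : ∀ w : E3, HasSum (fun y : P.points => α (dist w (y : E3))) 0) :
    ∀ r : ℝ, 0 ≤ r → α r = 0 := by
  obtain ⟨k₁, k₂, hli, hk₁, hk₂⟩ := exists_dualVectors P
  obtain ⟨-, hAi, -⟩ := radialKernel_props α L hα hL
  set Sf : ℤ → ℤ → ℂ := fun n j =>
    ∑ x ∈ P.motif, Complex.exp (↑(-2 * Real.pi * ⟪x, (n : ℝ) • k₁ + (j : ℝ) • k₂⟫) * Complex.I) with hSf
  set D : Set (ℤ × ℤ) := {p | Sf p.1 p.2 ≠ 0} with hD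
  have hwpos : 0 < P.motif.card := Finset.card_pos.2 P.motif_nonempty
  have hDwin : ∀ j₀ : ℤ, ∃ j : ℤ, j₀ ≤ j ∧ j < j₀ + P.motif.card ∧
      ∀ n₀ : ℤ, ∃ n : ℤ, n₀ ≤ n ∧ n < n₀ + P.motif.card ∧ (n, j) ∈ D :=
    stub_structureFactorWindows stub_expSumWindow P k₁ k₂
  refine radial_eq_zero_of_fourier_vanish_window α L hα hL hli D P.motif.card hwpos hDwin fun n j hnj => ?_
  have hdual : ∀ g ∈ P.lattice, ∃ m : ℤ, ⟪(n : ℝ) • k₁ + (j : ℝ) • k₂, g⟫ = (m : ℝ) := by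
    intro g hg
    obtain ⟨p, hp⟩ := hk₁ g hg
    obtain ⟨q, hq⟩ := hk₂ g hg
    refine ⟨n * p + j * q, ?_⟩
    rw [inner_add_left, real_inner_smul_left, real_inner_smul_left, hp, hq]
    push_cast
    ring
  have h := stub_braggOfInvisible P α L hL hAi hinv _ hdual
  exact (mul_eq_zero.1 h).resolve_left hnj

/-- **Registered stub `stub_allTemplatesKernel`** = `allTemplates_noInvisibleKernel` as a closed proposition. [folklore] -/
theorem stub_allTemplatesKernel :
    ∀ (P : Literature.MathematicalPhysics.StatisticalMechanics.PeriodicConfiguration 3) (α : ℝ → ℝ) (L : ℝ), Continuous α →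
      (∀ r : ℝ, L ≤ r → α r = 0) →
      (∀ w : EuclideanSpace ℝ (Fin 3),
        HasSum (fun y : P.points => α (dist w (y : EuclideanSpace ℝ (Fin 3)))) 0) →
      ∀ r : ℝ, 0 ≤ r → α r = 0 :=
  fun P α L hα hL hinv => allTemplates_noInvisibleKernel P α L hα hL hinv

end Summit.AtomisticToContinuum.Crystallization.Theorems.ThreeConeCertificateExactCertificate.AllTemplates

end
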